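import Literature.Computability.AlgebraicComplexity.GenericStabilizerCountingCore
import HarnessLib

/-!
# The parameter count for the transvection class: `#chart + dim(fixed forms) < N`

Topic `Literature/Computability/AlgebraicComplexity` (cell `val-lit`, row X3-Poonen05). Theorems only —
no definition, no named fact.

The arithmetic of the transvection class in the Matsumura–Monsky count behind Poonen 2005 Thm. 3
("the generic hypersurface has `Lin X = {1}`"): in `m ≥ 3` variables and degree `D ≥ 3`,
`(D, m) ≠ (3, 3)`, for a prime `p` and indices `i ≠ j`,

  `2(m - 1) + #T < N`,  `T = {e : |e| + (p-1) e_j = D}`,  `N = #{monomials of degree D}`,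

where `2(m - 1)` is the number of parameters of the chart `P = [a | e_j | e_k - ψ_k e_j]` of
transvections `1 + a ψᵀ` (`ψ_j = 1`, `a_i ≠ 0`) and `#T ≥ dim (Sym^D)^{τ₀}` bounds the forms fixed by
the model transvection `τ₀ : x_j ↦ x_j + x_i` (`TransvectionInvariantForms`). Proof: an explicit
injection into the monomials of degree `D` missing one monomial — `T ∋ e ↦ e + (p-1) e_j ε_j`
(monomials `x^e c_p(x_j)^{e_j}` ↦ their leading monomials, `x_j`-exponent divisible by `p`), the
`2m - 2` chart parameters ↦ monomials with `x_j`-exponent `1` (`x_j x_k x_i^{D-2}`,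
`x_j x_k x_l^{D-2}`, and one extra), and the monomial `x_j^t x_i^{D-t}` (`t ∈ {2, 3}`, `p ∤ t`) is
missed.

* `exists_ne_ne_ne` — a fourth index when `m ≥ 4`.
* `card_transvectionChart_lt_aux` — the injection, with the extra monomial as a parameter.
* **`card_transvectionChart_lt`** — the count, `D ≥ 3`, `m ≥ 3`, `(D = 3 → m ≥ 4)`.

Honest framing: bookkeeping for one class of a classical count ([MatsumuraMonsky1963], [Poonen2005]);
nothing here bears on VP versus VNP, which is NOT proved.

## References

* B. Poonen, *Varieties without extra automorphisms III: hypersurfaces*, Finite Fields Appl. 11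
  (2005) 230–268, Thm. 3 (held, p0002:L17–21). [Poonen2005]
* H. Matsumura, P. Monsky, *On the automorphisms of hypersurfaces*, J. Math. Kyoto Univ. 3 (1963/64)
  347–361 (not held, acq-11400). [MatsumuraMonsky1963]

## Tree

`degMonomials`, `mem_degMonomials_iff`; `single_add_single_mem`, `single_add_single_add_single_mem`,
`two_apply`, `three_apply`, `exists_ne_ne` (`GenericStabilizerCountingCore`).

## Provenance

Cell `val-lit`, seat `val-lit-x3` generation 9 (cross-ladder literature seat; row X3 residue).
-/

namespace Literature.Computability.AlgebraicComplexity

open TrivialStabilizerCount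

variable {m : ℕ}

/-- Four pairwise constraints can be avoided among `m ≥ 4` indices. [cite: Poonen2005, Thm. 3 (proof:
dimension count of [MM]; bookkeeping)] -/
theorem exists_ne_ne_ne (hm : 4 ≤ m) (i j l : Fin m) : ∃ l' : Fin m, l' ≠ i ∧ l' ≠ j ∧ l' ≠ l := by
  by_contra h
  push Not at h
  have hsub : (Finset.univ : Finset (Fin m)) ⊆ {i, j, l} := fun l' _ => by
    rcases eq_or_ne l' i with h1 | h1
    · simp [h1]
    rcases eq_or_ne l' j with h2 | h2
    · simp [h2]
    · simp [h l' h1 h2]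
  have := (Finset.card_le_card hsub).trans
    ((Finset.card_insert_le i {j, l}).trans (Nat.succ_le_succ (Finset.card_insert_le j {l})))
  rw [Finset.card_univ, Fintype.card_fin, Finset.card_singleton] at this
  omega

/-- **The injection.** Given `i ≠ j`, a third index `l`, a prime bound `p ≥ 2`, `D ≥ 3`, and an
"extra" monomial `X` of degree `D` with `x_j`-exponent `1` different from all `x_j x_k x_i^{D-2}`
(`k ≠ j`) and all `x_j x_k x_l^{D-2}` (`k ≠ i, j`), the `2(m-1)` chart parameters together with
`T = {e : |e| + (p-1) e_j = D}` inject into the monomials of degree `D` minus one monomial, so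
`2(m-1) + #T < N`. [cite: Poonen2005, Thm. 3 (proof: dimension count of [MM]; transvection class)] -/
theorem card_transvectionChart_lt_aux {D p : ℕ} (hp : 2 ≤ p) (hD : 3 ≤ D) {i j l : Fin m}
    (hij : i ≠ j) (hli : l ≠ i) (hlj : l ≠ j) (X : Fin m →₀ ℕ) (hX : X ∈ degMonomials (Fin m) D)
    (hXj : X j = 1)
    (hXA : ∀ k : Fin m, k ≠ j → X ≠ Finsupp.single j 1 + Finsupp.single k 1 + Finsupp.single i (D - 2))
    (hXB : ∀ k : Fin m, k ≠ j → k ≠ i →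
      X ≠ Finsupp.single j 1 + Finsupp.single k 1 + Finsupp.single l (D - 2)) :
    Fintype.card ({k : Fin m // k ≠ j} ⊕ {k : Fin m // k ≠ j}) +
        (((Finset.range (D + 1)).biUnion (degMonomials (Fin m))).filter
          fun e : Fin m →₀ ℕ => e.degree + (p - 1) * e j = D).card <
      (degMonomials (Fin m) D).card := by
  classical
  set T := ((Finset.range (D + 1)).biUnion (degMonomials (Fin m))).filter
    fun e : Fin m →₀ ℕ => e.degree + (p - 1) * e j = D with hT
  have hmemT : ∀ e ∈ T, e.degree + (p - 1) * e j = D := fun e he => (Finset.mem_filter.mp he).2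
  -- the missed monomial `x_j^t x_i^{D-t}`, `t = 3` if `p = 2`, else `t = 2`
  set t : ℕ := if p = 2 then 3 else 2 with ht
  have ht' : (t = 3 ∧ p = 2) ∨ (t = 2 ∧ p ≠ 2) := by
    by_cases h : p = 2
    · exact Or.inl ⟨by rw [ht, if_pos h], h⟩
    · exact Or.inr ⟨by rw [ht, if_neg h], h⟩
  have htD : t ≤ D := by rcases ht' with ⟨h1, _⟩ | ⟨h1, _⟩ <;> omega
  have ht1 : t ≠ 1 := by rcases ht' with ⟨h1, _⟩ | ⟨h1, _⟩ <;> omega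
  have hpt : ∀ n : ℕ, p * n ≠ t := by
    intro n h
    rcases ht' with ⟨h1, h2⟩ | ⟨h1, h2⟩
    · rw [h1, h2] at h; omega
    · rw [h1] at h
      rcases Nat.eq_zero_or_pos n with hn | hn
      · rw [hn, mul_zero] at h; omega
      · have h3 : 3 ≤ p := by omega
        have := Nat.mul_le_mul h3 hn
        omega
  set e₀ : Fin m →₀ ℕ := Finsupp.single j t + Finsupp.single i (D - t) with he₀
  have he₀mem : e₀ ∈ degMonomials (Fin m) D := single_add_single_mem j i (by omega)
  have he₀j : e₀ j = t := by rw [he₀, two_apply]; simp [hij]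
  -- the map
  let Λ : ({k : Fin m // k ≠ j} ⊕ {k : Fin m // k ≠ j}) ⊕ ↥T → (Fin m →₀ ℕ) :=
    Sum.elim
      (Sum.elim (fun k => Finsupp.single j 1 + Finsupp.single (k : Fin m) 1 + Finsupp.single i (D - 2))
        (fun k => if (k : Fin m) = i then X
          else Finsupp.single j 1 + Finsupp.single (k : Fin m) 1 + Finsupp.single l (D - 2)))
      (fun e => (e : Fin m →₀ ℕ) + Finsupp.single j ((p - 1) * (e : Fin m →₀ ℕ) j))
  -- values at `j` and `i`
  have hAj : ∀ k : {k : Fin m // k ≠ j},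
      (Finsupp.single j 1 + Finsupp.single (k : Fin m) 1 + Finsupp.single i (D - 2) : Fin m →₀ ℕ) j =
        1 := by
    intro k; rw [three_apply]; simp [k.2, hij]
  have hAi : ∀ k : {k : Fin m // k ≠ j}, D - 2 ≤
      (Finsupp.single j 1 + Finsupp.single (k : Fin m) 1 + Finsupp.single i (D - 2) : Fin m →₀ ℕ) i := by
    intro k; rw [three_apply]; simp [hij.symm]
  have hBj : ∀ k : {k : Fin m // k ≠ j},
      (Finsupp.single j 1 + Finsupp.single (k : Fin m) 1 + Finsupp.single l (D - 2) : Fin m →₀ ℕ) j =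
        1 := by
    intro k; rw [three_apply]; simp [k.2, hlj]
  have hBi : ∀ k : {k : Fin m // k ≠ j}, (k : Fin m) ≠ i →
      (Finsupp.single j 1 + Finsupp.single (k : Fin m) 1 + Finsupp.single l (D - 2) : Fin m →₀ ℕ) i =
        0 := by
    intro k hk; rw [three_apply]; simp [hk, hij.symm, hli]
  have hΛj_inl : ∀ x : {k : Fin m // k ≠ j} ⊕ {k : Fin m // k ≠ j}, Λ (Sum.inl x) j = 1 := by
    rintro (k | k)
    · exact hAj k
    · change (if (k : Fin m) = i then X
        else Finsupp.single j 1 + Finsupp.single (k : Fin m) 1 + Finsupp.single l (D - 2)) j = 1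
      split_ifs
      · exact hXj
      · exact hBj k
  have hΛj_inr : ∀ e : ↥T, Λ (Sum.inr e) j = p * (e : Fin m →₀ ℕ) j := by
    intro e
    change ((e : Fin m →₀ ℕ) + Finsupp.single j ((p - 1) * (e : Fin m →₀ ℕ) j)) j = _
    rw [Finsupp.add_apply, Finsupp.single_eq_same]
    have : p - 1 + 1 = p := by omega
    nth_rw 1 [← one_mul ((e : Fin m →₀ ℕ) j)]
    rw [← Nat.add_mul, add_comm, this]
  -- `Λ` lands in the monomials of degree `D` other than `e₀`
  have hmem : ∀ x, Λ x ∈ (degMonomials (Fin m) D).erase e₀ := by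
    intro x
    refine Finset.mem_erase.mpr ⟨fun h => ?_, ?_⟩
    · -- `Λ x ≠ e₀`: compare the `x_j`-exponents
      have hj := DFunLike.congr_fun h j
      rw [he₀j] at hj
      rcases x with x | e
      · rw [hΛj_inl] at hj; exact ht1 hj.symm
      · rw [hΛj_inr] at hj; exact hpt _ hj
    · rcases x with (k | k) | e
      · exact single_add_single_add_single_mem j k i (by omega)
      · change (if (k : Fin m) = i then X
          else Finsupp.single j 1 + Finsupp.single (k : Fin m) 1 + Finsupp.single l (D - 2)) ∈ _
        split_ifs
        · exact hX
        · exact single_add_single_add_single_mem j k l (by omega)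
      · change (e : Fin m →₀ ℕ) + Finsupp.single j ((p - 1) * (e : Fin m →₀ ℕ) j) ∈ _
        rw [mem_degMonomials_iff, map_add, Finsupp.degree_single]
        exact hmemT e e.2
  -- `Λ` is injective
  have hAinj : ∀ k k' : {k : Fin m // k ≠ j},
      Finsupp.single j 1 + Finsupp.single (k : Fin m) 1 + Finsupp.single i (D - 2) =
        Finsupp.single j 1 + Finsupp.single (k' : Fin m) 1 + Finsupp.single i (D - 2) → k = k' := by
    intro k k' h
    exact Subtype.ext (Finsupp.single_left_injective one_ne_zero
      (add_left_cancel (add_right_cancel h)))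
  have hBinj : ∀ k k' : {k : Fin m // k ≠ j},
      Finsupp.single j 1 + Finsupp.single (k : Fin m) 1 + Finsupp.single l (D - 2) =
        Finsupp.single j 1 + Finsupp.single (k' : Fin m) 1 + Finsupp.single l (D - 2) → k = k' := by
    intro k k' h
    exact Subtype.ext (Finsupp.single_left_injective one_ne_zero
      (add_left_cancel (add_right_cancel h)))
  -- mixed pairs inside the chart block are separated by the `x_i`-exponent or by `hXA`, `hXB`
  have hAB : ∀ k k' : {k : Fin m // k ≠ j}, Λ (Sum.inl (Sum.inl k)) ≠ Λ (Sum.inl (Sum.inr k')) := by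
    intro k k' h
    change Finsupp.single j 1 + Finsupp.single (k : Fin m) 1 + Finsupp.single i (D - 2) =
      (if (k' : Fin m) = i then X
        else Finsupp.single j 1 + Finsupp.single (k' : Fin m) 1 + Finsupp.single l (D - 2)) at h
    split_ifs at h with hk'
    · exact hXA k k.2 h.symm
    · have hi := DFunLike.congr_fun h i
      rw [hBi k' hk'] at hi
      have := hAi k
      omega
  have hinl_inr : ∀ (x : {k : Fin m // k ≠ j} ⊕ {k : Fin m // k ≠ j}) (e : ↥T),
      Λ (Sum.inl x) ≠ Λ (Sum.inr e) := by
    intro x e h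
    have hj := DFunLike.congr_fun h j
    rw [hΛj_inl, hΛj_inr] at hj
    rcases Nat.eq_zero_or_pos ((e : Fin m →₀ ℕ) j) with h0 | h0
    · rw [h0, mul_zero] at hj; exact one_ne_zero hj
    · nlinarith
  have hinj : Function.Injective Λ := by
    rintro ((k | k) | e) ((k' | k') | e') h
    · rw [hAinj k k' h]
    · exact absurd h (hAB k k')
    · exact absurd h (hinl_inr _ e')
    · exact absurd h.symm (hAB k' k)
    · change (if (k : Fin m) = i then X
          else Finsupp.single j 1 + Finsupp.single (k : Fin m) 1 + Finsupp.single l (D - 2)) =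
        (if (k' : Fin m) = i then X
          else Finsupp.single j 1 + Finsupp.single (k' : Fin m) 1 + Finsupp.single l (D - 2)) at h
      split_ifs at h with hk hk' hk'
      · exact congrArg _ (congrArg _ (Subtype.ext (hk.trans hk'.symm)))
      · exact absurd h (hXB k' k'.2 hk')
      · exact absurd h.symm (hXB k k.2 hk)
      · rw [hBinj k k' h]
    · exact absurd h (hinl_inr _ e')
    · exact absurd h.symm (hinl_inr _ e)
    · exact absurd h.symm (hinl_inr _ e)
    · change (e : Fin m →₀ ℕ) + Finsupp.single j ((p - 1) * (e : Fin m →₀ ℕ) j) =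
        (e' : Fin m →₀ ℕ) + Finsupp.single j ((p - 1) * (e' : Fin m →₀ ℕ) j) at h
      have hj := DFunLike.congr_fun h j
      have hj1 := hΛj_inr e
      have hj2 := hΛj_inr e'
      change ((e : Fin m →₀ ℕ) + Finsupp.single j ((p - 1) * (e : Fin m →₀ ℕ) j)) j = _ at hj1
      change ((e' : Fin m →₀ ℕ) + Finsupp.single j ((p - 1) * (e' : Fin m →₀ ℕ) j)) j = _ at hj2
      rw [hj1, hj2] at hj
      have hee : (e : Fin m →₀ ℕ) j = (e' : Fin m →₀ ℕ) j := Nat.eq_of_mul_eq_mul_left (by omega) hj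
      rw [hee] at h
      exact congrArg _ (Subtype.ext (add_right_cancel h))
  -- count
  have hcard := Finset.card_le_card_of_injOn (s := Finset.univ) Λ (fun x _ => hmem x) (hinj.injOn)
  rw [Finset.card_univ, Fintype.card_sum, Fintype.card_coe, Finset.card_erase_of_mem he₀mem] at hcard
  have hpos : 0 < (degMonomials (Fin m) D).card := Finset.card_pos.mpr ⟨e₀, he₀mem⟩
  omega

/-- **The count for the transvection class**: for a prime `p`, `D ≥ 3`, `m ≥ 3`, `(D = 3 → m ≥ 4)`
and `i ≠ j` in `[m]`,  `2(m-1) + #T < N`  with `T = {e : |e| + (p-1) e_j = D}` (an upper bound for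
`dim (Sym^D)^{τ₀}`, `τ₀ : x_j ↦ x_j + x_i`) and `N = #{monomials of degree D}` — `dim(chart) +
dim(fixed forms) < dim Sym^D` for the class of transvections in the Matsumura–Monsky count. (At
`(D, m) = (3, 3)` the inequality fails: `4 + #T = N = 10` for `p = 2`.)
[cite: Poonen2005, Thm. 3 (proof: dimension count of [MM]; transvection class)] -/
theorem card_transvectionChart_lt {D : ℕ} (p : ℕ) [Fact p.Prime] (hD : 3 ≤ D) (hm : 3 ≤ m)
    (h33 : D = 3 → 4 ≤ m) {i j : Fin m} (hij : i ≠ j) :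
    Fintype.card ({k : Fin m // k ≠ j} ⊕ {k : Fin m // k ≠ j}) +
        (((Finset.range (D + 1)).biUnion (degMonomials (Fin m))).filter
          fun e : Fin m →₀ ℕ => e.degree + (p - 1) * e j = D).card <
      (degMonomials (Fin m) D).card := by
  classical
  have hp : 2 ≤ p := (Fact.out : p.Prime).two_le
  obtain ⟨l, hli, hlj⟩ := exists_ne_ne hm i j
  by_cases hD3 : D = 3
  · -- extra monomial `x_j x_{l'}²`
    obtain ⟨l', hl'i, hl'j, hl'l⟩ := exists_ne_ne_ne (h33 hD3) i j l
    refine card_transvectionChart_lt_aux hp hD hij hli hlj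
      (Finsupp.single j 1 + Finsupp.single l' 2) (single_add_single_mem j l' (by omega)) ?_ ?_ ?_
    · rw [two_apply]; simp [hl'j]
    · intro k hk h
      have hi := DFunLike.congr_fun h i
      simp only [two_apply, three_apply, hij.symm, hl'i, if_false, add_zero, if_true] at hi
      omega
    · intro k hk hki h
      have hl := DFunLike.congr_fun h l
      simp only [two_apply, three_apply, hlj.symm, hl'l, if_false, add_zero, if_true, zero_add] at hl
      split_ifs at hl <;> omega
  · -- extra monomial `x_j x_i x_l^{D-2}`
    refine card_transvectionChart_lt_aux hp hD hij hli hlj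
      (Finsupp.single j 1 + Finsupp.single i 1 + Finsupp.single l (D - 2))
      (single_add_single_add_single_mem j i l (by omega)) ?_ ?_ ?_
    · rw [three_apply]; simp [hij, hlj]
    · intro k hk h
      have hi := DFunLike.congr_fun h i
      simp only [three_apply, hij.symm, hli, if_false, if_true, zero_add, add_zero] at hi
      split_ifs at hi <;> omega
    · intro k hk hki h
      have hi := DFunLike.congr_fun h i
      simp only [three_apply, hij.symm, hli, hki, if_false, if_true, zero_add, add_zero] at hi
      exact one_ne_zero hi

end Literature.Computability.AlgebraicComplexity
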